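/-
Copyright (c) 2026 the pub-hodgecm-mathlib formalisation cell (harness21).  Prover seat hodgecm-mathlib-LH5-p04 (g10), 2026-09-03.  E1 row 56-B1 «(U7)-RAM: THE GEODESIC
APARTMENT FOR ANY ISOMETRIC INVOLUTION ∕ AT A TAME RAMIFIED PLACE» (E1 keeper ∕ dealer F0P3a-p03 (g30) 03:19:57Z «= VERDICT» on census R56; LEAD F0P3a-plan (g16) T15-42 03:22:05Z «TAME RE-OPENS as a GO-LOW ROAD; WILD = PRINT»; rule 20).  Twin of ★ E1 row 39γ
`UnitaryLatticeTreeGeodesicApartment` (F0P3a-p01 (g23)), re-lettered over ★ T1 R5a `UnitaryLatticeTreeApartmentOfInvolution` ∕ ★ `UnitaryLatticeTreeFramesOfInvolution` (B-p14).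
-/
import Literature.NumberTheory.Automorphic.UnitaryLatticeTreeGeodesicApartment     -- ★ row 39γ p853251 (F0P3a-p01 (g23)): the UNRAMIFIED file — its datum-FREE heads `mapGL_weylLongU_apartmentEnum`, `coe_apartmentEnum_zero` are used BY NAME; brings ★ ApartmentPath `…_of_isVertex`, ★ `SequencePath.*`, `TreeLayers.dist_iso_apply`
import Literature.NumberTheory.Automorphic.UnitaryLatticeTreeApartmentOfInvolution  -- ★ T1 R5a (B-p14 (g36)): `exists_coe_eq_diagonal_zpow_of_involution`, `latt_diagonal_map_zpow_eq`, `isSelfDualLattice_latt_diagonal_zpow_of_v`, `isVertexLattice_two_latt_diagonal_zpow_of_v`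
import HarnessLib

/-!
# The lattice tree of `U(3)`: EVERY GEODESIC SEGMENT LIES IN A TRANSLATE OF THE STANDARD APARTMENT — FOR ANY ISOMETRIC INVOLUTION (hypothesis-style)
# (Bruhat–Tits 1972 (7.4.18), §10; Tits 1979 §2.4, §3.3.3; Serre, *Trees* I.2.2, II.1.1)

Topic `NumberTheory/Automorphic`; namespace `Literature.NumberTheory.Automorphic.UnitaryLatticeTree` (T1a currency of ★ `UnitaryLatticeTreeDefs`).  THEOREMS ONLY (no definition, no
instance, no notation, no named fact, no `sorry`).  Cell `pub/hodgecm-mathlib` (D-0151), crux H413 = `stmt-HodgeConjecture-24833`; E1 row 56-B1 = brick B1 of census R56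
`F0/P3c/LH5/LH5-p04/g10/r56/CENSUS-R56-ramified-tree.v1.md` (the one missing input of the TAME ramified slice of the (R-SS) road: (U7) geodesic inclusion reads the apartment
enumeration, which ★ row 39γ proves under the UNRAMIFIED datum only).  HONEST LABEL: count-neutral lattice-model base layer of the GO-LOW TAME road (LEAD T15-42; (R-SS) banked PAYDOWN-UNR; WILD `v ∣ 2` stays
PRINT of record); h413 OPEN; HC_CM is proved only modulo the 2 remaining named inputs (hLiu418 24832, h413 24833) until rung 0 closes; nothing printed is asserted here.

WHY NO UNRAMIFIED DATUM.  ★ row 39γ reads `hd : UnramifiedLocalConjDatum σ ϖ` for three things: (a) `σϖ = ϖ`, making `t_a = diag(ϖ^a, 1, ϖ^{−a})` unitary — but for ANY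
isometric involution the unitary `diag(ϖ^a, 1, (σϖ)^{−a})` (★ R5a `exists_coe_eq_diagonal_zpow_of_involution`) spans the SAME lattices `L_a = latt diag(ϖ^a,1,ϖ^{−a})`,
`L′_a = latt diag(ϖ^a,1,ϖ^{1−a})` (★ R5a `latt_diagonal_map_zpow_eq`, `isSelfDualLattice_latt_diagonal_zpow_of_v`, `isVertexLattice_two_latt_diagonal_zpow_of_v`); (b) tree-ness;
(c) the frames `L = κ·L_a` (`κ ∈ K₀`) of self-dual vertices and transitivity on type-`2` vertices.  So §1 (enumeration `A(2a) = L_a`, `A(2a+1) = L′_{a+1}`, adjacency,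
injectivity, distances) holds for ANY valuation-preserving involution and ANY uniformiser with ★ row 39γ's conclusions VERBATIM; §2 is HYPOTHESIS-STYLE over `(hT : IsTree)`, the
frames `hfr` and the type-`2` transitivity `htr₂` (shape of ★ `isTree_latticeGraph_three_of_transitive`); the sibling `UnitaryLatticeTreeGeodesicInclusionOfInvolution` DISCHARGES them at a TAME RAMIFIED place (`σϖ = −ϖ`, `hres`,
`|2| = 1`, `hnorm` — ★ `ramifiedBlock_adicCompletion`'s block) by ★ `isTree_latticeGraph_three_of_neg`, ★ `exists_unitary_mapGL_stdLattice_eq_of_isSelfDualLattice_of_v_two` + ★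
`exists_frame_mapGL_stdLattice` (Cartan of any involution), ★ `forall_isVertexLattice_two_exists_mapGL_N₁_eq_of_neg`.  (At an UNRAMIFIED place the three hypotheses are ★
`isTree_latticeGraph_three_of_unramified`, ★ `exists_frame_three_of_isSelfDualLattice`, ★ `forall_isVertexLattice_two_exists_mapGL_N₁_eq`: §2 re-derives ★ row 39γ.)
Heads: §1 `exists_apartmentEnum_of_involution`, `latticeGraph_adj_apartmentEnum_succ_of_involution`, `latt_diagonal_zpow_one_zpow_eq_iff_of_v`, `apartmentEnum_injective_of_involution`,
`dist_apartmentEnum_of_involution`, `exists_eq_apartmentEnum_of_dist_add_dist_eq_of_involution`, `dist_latticeGraphIso_apartmentEnum_of_involution`,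
`exists_eq_latticeGraphIso_apartmentEnum_of_dist_add_dist_eq_of_involution` (★ row 39γ's datum-free `mapGL_weylLongU_apartmentEnum`, `coe_apartmentEnum_zero` are used BY NAME);
§2 `exists_latticeGraphIso_apartmentEnum_of_isSelfDualLattice₂_of_involution`, `exists_eq_latticeGraphIso_apartmentEnum_neg_one_of_involution`,
`exists_latticeGraphIso_apartmentEnum_of_isSelfDualLattice_of_involution`, **`…_pair_of_involution`**, **`…_geodesic_of_involution`**, **`…_of_adj_of_dist_of_involution`** ((U7)'s shape);
(the tame `_of_neg` dischargers and the (U7) inclusion heads of involution are in the sibling file `UnitaryLatticeTreeGeodesicInclusionOfInvolution`).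

## References
* [BruhatTits1972] F. Bruhat, J. Tits, *Groupes réductifs sur un corps local I*, Publ. Math. IHÉS 41 (1972), (7.4.18) (two facets lie in a common apartment), (4.4.3), §10.
* [Tits1979] J. Tits, *Reductive groups over local fields*, PSPM 33.1 (1979), §2.4 (the ramified `²A₂`: both vertices special), §3.3.3.
* [Serre1980Trees] J.-P. Serre, *Trees* (1980), Ch. I §2.2 Prop. 8 (geodesics in a tree are unique), Ch. II §1.1.
* [SchneiderStuhler1997] P. Schneider, U. Stuhler, *Representation theory and sheaves on the Bruhat–Tits building*, Publ. Math. IHÉS 85 (1997), Ch. I Prop. I.3.1 p. 118 (U7).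
-/

set_option autoImplicit false

open scoped Valued WithZero Matrix MatrixGroups

namespace Literature.NumberTheory.Automorphic.UnitaryLatticeTree

open _root_.SimpleGraph Literature.NumberTheory.Automorphic Literature.NumberTheory.Automorphic.HermitianLattice
open Literature.NumberTheory.Automorphic.CartanUnique (uniformizer_ne_zero)
open Literature.Combinatorics.SimpleGraph

variable {K : Type*} [Field K] [Valued K ℤᵐ⁰] {σ : K →+* K} {ϖ : K}

/-! ## §1 The standard apartment, enumerated, for ANY isometric involution and ANY uniformiser -/

/-- **THE ENUMERATED APARTMENT EXISTS for any isometric involution `σ` and any uniformiser `ϖ`**: there is `A : ℤ → {vertices}` with `A(2a) = L_a = latt diag(ϖ^a, 1, ϖ^{−a})`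
and `A(2a+1) = L′_{a+1} = latt diag(ϖ^{a+1}, 1, ϖ^{−a})` — ★ `exists_apartmentEnum`'s conclusion VERBATIM; the vertices are certified by ★ R5a's `…_of_v` lemmas (the unitary
witness is `diag(ϖ^a, 1, (σϖ)^{−a})`, which spans the same lattices). [cite: BruhatTits1972, §10] [cite: Tits1979, §3.3.3] [cite: Serre1980Trees, II.1.1] -/
theorem exists_apartmentEnum_of_involution (hσ : ∀ x, σ (σ x) = x) (hvσ : ∀ a, Valued.v (σ a) = Valued.v a) (hϖ : Valued.v ϖ = WithZero.exp (-1 : ℤ)) :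
    ∃ A : ℤ → {M : Submodule 𝒪[K] (Fin 3 → K) // IsVertex σ ϖ ((StdForm.antidiagonal 3).over K) M},
      (∀ a : ℤ, (A (2 * a)).1 = latt (Matrix.diagonal ![ϖ ^ a, (1 : K), ϖ ^ (-a)])) ∧
      (∀ a : ℤ, (A (2 * a + 1)).1 = latt (Matrix.diagonal ![ϖ ^ (a + 1), (1 : K), ϖ ^ (-a)])) := by
  have hV : ∀ j : ℤ, IsVertex σ ϖ ((StdForm.antidiagonal 3).over K) (latt (Matrix.diagonal ![ϖ ^ ((j + 1) / 2), (1 : K), ϖ ^ (-(j / 2))])) := by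
    intro j
    rcases Int.emod_two_eq_zero_or_one j with h | h
    · have hj : (j + 1) / 2 = j / 2 := by omega
      rw [hj]
      exact ⟨0, isSelfDualLattice_latt_diagonal_zpow_of_v hσ hvσ hϖ (j / 2)⟩
    · have hj : (j + 1) / 2 = j / 2 + 1 := by omega
      have hj' : (-(j / 2) : ℤ) = 1 - (j / 2 + 1) := by ring
      rw [hj, hj']
      exact ⟨2, isVertexLattice_two_latt_diagonal_zpow_of_v hσ hvσ hϖ (j / 2 + 1)⟩
  refine ⟨fun j => ⟨_, hV j⟩, fun a => ?_, fun a => ?_⟩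
  · show latt (Matrix.diagonal ![ϖ ^ ((2 * a + 1) / 2), (1 : K), ϖ ^ (-(2 * a / 2))]) = _
    have h1 : (2 * a + 1) / 2 = a := by omega
    have h2 : 2 * a / 2 = a := by omega
    rw [h1, h2]
  · show latt (Matrix.diagonal ![ϖ ^ ((2 * a + 1 + 1) / 2), (1 : K), ϖ ^ (-((2 * a + 1) / 2))]) = _
    have h1 : (2 * a + 1 + 1) / 2 = a + 1 := by omega
    have h2 : (2 * a + 1) / 2 = a := by omega
    rw [h1, h2]

/-- **Consecutive apartment vertices are adjacent: `A j ~ A (j+1)`**, any isometric involution (★ ApartmentPath's witness-free edges `…_of_isVertex`).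
[cite: BruhatTits1972, §10] [cite: Serre1980Trees, II.1.1] -/
theorem latticeGraph_adj_apartmentEnum_succ_of_involution (hσ : ∀ x, σ (σ x) = x) (hvσ : ∀ a, Valued.v (σ a) = Valued.v a) (hϖ : Valued.v ϖ = WithZero.exp (-1 : ℤ))
    (A : ℤ → {M : Submodule 𝒪[K] (Fin 3 → K) // IsVertex σ ϖ ((StdForm.antidiagonal 3).over K) M})
    (hA0 : ∀ a : ℤ, (A (2 * a)).1 = latt (Matrix.diagonal ![ϖ ^ a, (1 : K), ϖ ^ (-a)]))
    (hA1 : ∀ a : ℤ, (A (2 * a + 1)).1 = latt (Matrix.diagonal ![ϖ ^ (a + 1), (1 : K), ϖ ^ (-a)])) (j : ℤ) : (latticeGraph σ ϖ ((StdForm.antidiagonal 3).over K)).Adj (A j) (A (j + 1)) := by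
  obtain ⟨a, rfl | rfl⟩ := Int.even_or_odd' j
  · have e1 : A (2 * a) = ⟨latt (Matrix.diagonal ![ϖ ^ a, (1 : K), ϖ ^ (-a)]), ⟨0, isSelfDualLattice_latt_diagonal_zpow_of_v hσ hvσ hϖ a⟩⟩ :=
      Subtype.ext (hA0 a)
    have e2 : A (2 * a + 1) = ⟨latt (Matrix.diagonal ![ϖ ^ (a + 1), (1 : K), ϖ ^ (1 - (a + 1))]),
        ⟨2, isVertexLattice_two_latt_diagonal_zpow_of_v hσ hvσ hϖ (a + 1)⟩⟩ :=
      Subtype.ext (by rw [hA1 a]; change _ = latt (Matrix.diagonal ![ϖ ^ (a + 1), (1 : K), ϖ ^ (1 - (a + 1))]); rw [show (1 - (a + 1) : ℤ) = -a by ring])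
    rw [e1, e2]
    exact latticeGraph_adj_apartment_selfDual_two_succ_of_isVertex hϖ a _ _
  · have e1 : A (2 * a + 1) = ⟨latt (Matrix.diagonal ![ϖ ^ (a + 1), (1 : K), ϖ ^ (1 - (a + 1))]),
        ⟨2, isVertexLattice_two_latt_diagonal_zpow_of_v hσ hvσ hϖ (a + 1)⟩⟩ :=
      Subtype.ext (by rw [hA1 a]; change _ = latt (Matrix.diagonal ![ϖ ^ (a + 1), (1 : K), ϖ ^ (1 - (a + 1))]); rw [show (1 - (a + 1) : ℤ) = -a by ring])
    have e2 : A (2 * a + 1 + 1) = ⟨latt (Matrix.diagonal ![ϖ ^ (a + 1), (1 : K), ϖ ^ (-(a + 1))]),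
        ⟨0, isSelfDualLattice_latt_diagonal_zpow_of_v hσ hvσ hϖ (a + 1)⟩⟩ :=
      Subtype.ext (by rw [show 2 * a + 1 + 1 = 2 * (a + 1) by ring, hA0 (a + 1)])
    rw [e1, e2]
    exact latticeGraph_adj_apartment_two_selfDual_of_isVertex hϖ (a + 1) _ _

/-- **Diagonal apartment lattices are determined by their exponents** (any uniformiser): `latt diag(ϖ^p, 1, ϖ^q) = latt diag(ϖ^{p′}, 1, ϖ^{q′}) ↔ p = p′ ∧ q = q′`.
[cite: Serre1980Trees, II.1.1] -/
theorem latt_diagonal_zpow_one_zpow_eq_iff_of_v (hϖ : Valued.v ϖ = WithZero.exp (-1 : ℤ)) (p q p' q' : ℤ) :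
    latt (Matrix.diagonal ![ϖ ^ p, (1 : K), ϖ ^ q]) = latt (Matrix.diagonal ![ϖ ^ p', (1 : K), ϖ ^ q']) ↔ p = p' ∧ q = q' := by
  have hϖ0 : ϖ ≠ 0 := uniformizer_ne_zero hϖ
  have hne : ∀ (r s : ℤ) (i : Fin 3), (![ϖ ^ r, (1 : K), ϖ ^ s] : Fin 3 → K) i ≠ 0 := by
    intro r s i
    fin_cases i
    · exact zpow_ne_zero r hϖ0
    · exact one_ne_zero
    · exact zpow_ne_zero s hϖ0
  constructor
  · intro h
    have h1 := (latt_diagonal_le_latt_diagonal_iff (hne p q) (hne p' q')).1 h.le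
    have h2 := (latt_diagonal_le_latt_diagonal_iff (hne p' q') (hne p q)).1 h.ge
    have e0 : Valued.v (ϖ ^ p) ≤ Valued.v (ϖ ^ p') := h1 0
    have e0' : Valued.v (ϖ ^ p') ≤ Valued.v (ϖ ^ p) := h2 0
    have e2 : Valued.v (ϖ ^ q) ≤ Valued.v (ϖ ^ q') := h1 2
    have e2' : Valued.v (ϖ ^ q') ≤ Valued.v (ϖ ^ q) := h2 2
    rw [v_zpow_le_v_zpow_iff hϖ] at e0 e0' e2 e2'
    exact ⟨le_antisymm e0' e0, le_antisymm e2' e2⟩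
  · rintro ⟨rfl, rfl⟩
    rfl

/-- **The enumeration is injective** (any uniformiser). [cite: BruhatTits1972, §10] [cite: Serre1980Trees, II.1.1] -/
theorem apartmentEnum_injective_of_involution (hϖ : Valued.v ϖ = WithZero.exp (-1 : ℤ))
    (A : ℤ → {M : Submodule 𝒪[K] (Fin 3 → K) // IsVertex σ ϖ ((StdForm.antidiagonal 3).over K) M})
    (hA0 : ∀ a : ℤ, (A (2 * a)).1 = latt (Matrix.diagonal ![ϖ ^ a, (1 : K), ϖ ^ (-a)]))
    (hA1 : ∀ a : ℤ, (A (2 * a + 1)).1 = latt (Matrix.diagonal ![ϖ ^ (a + 1), (1 : K), ϖ ^ (-a)])) :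
    Function.Injective A := by
  intro j j' h
  have h' : (A j).1 = (A j').1 := by rw [h]
  obtain ⟨a, rfl | rfl⟩ := Int.even_or_odd' j <;> obtain ⟨b, rfl | rfl⟩ := Int.even_or_odd' j'
  · rw [hA0, hA0, latt_diagonal_zpow_one_zpow_eq_iff_of_v hϖ] at h'; omega
  · rw [hA0, hA1, latt_diagonal_zpow_one_zpow_eq_iff_of_v hϖ] at h'; omega
  · rw [hA1, hA0, latt_diagonal_zpow_one_zpow_eq_iff_of_v hϖ] at h'; omega
  · rw [hA1, hA1, latt_diagonal_zpow_one_zpow_eq_iff_of_v hϖ] at h'; omega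

section Enum

variable (hσ : ∀ x, σ (σ x) = x) (hvσ : ∀ a, Valued.v (σ a) = Valued.v a) (hϖ : Valued.v ϖ = WithZero.exp (-1 : ℤ))
  (A : ℤ → {M : Submodule 𝒪[K] (Fin 3 → K) // IsVertex σ ϖ ((StdForm.antidiagonal 3).over K) M})
  (hA0 : ∀ a : ℤ, (A (2 * a)).1 = latt (Matrix.diagonal ![ϖ ^ a, (1 : K), ϖ ^ (-a)]))
  (hA1 : ∀ a : ℤ, (A (2 * a + 1)).1 = latt (Matrix.diagonal ![ϖ ^ (a + 1), (1 : K), ϖ ^ (-a)]))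
include hσ hvσ hϖ hA0 hA1

/-- **`dist (A i) (A k) = |k − i|`** whenever the lattice graph is a tree (`hT`; ★ at unramified places, ★ `isTree_latticeGraph_three_of_neg` at tame ramified ones).
[cite: Serre1980Trees, I.2.2 Prop. 8; II.1.1] -/
theorem dist_apartmentEnum_of_involution (hT : (latticeGraph σ ϖ ((StdForm.antidiagonal 3).over K)).IsTree) (i k : ℤ) :
    (latticeGraph σ ϖ ((StdForm.antidiagonal 3).over K)).dist (A i) (A k) = (k - i).natAbs :=
  SequencePath.dist_eq_natAbs hT A (latticeGraph_adj_apartmentEnum_succ_of_involution hσ hvσ hϖ A hA0 hA1) (apartmentEnum_injective_of_involution hϖ A hA0 hA1) i k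

/-- **Every vertex on the geodesic `[A i, A k]` (`i ≤ k`) is an `A j`, `i ≤ j ≤ k`** (tree hypothesis `hT`). [cite: Serre1980Trees, I.2.2 Prop. 8] [cite: BruhatTits1972, §10] -/
theorem exists_eq_apartmentEnum_of_dist_add_dist_eq_of_involution (hT : (latticeGraph σ ϖ ((StdForm.antidiagonal 3).over K)).IsTree) {i k : ℤ} (hik : i ≤ k)
    {w : {M : Submodule 𝒪[K] (Fin 3 → K) // IsVertex σ ϖ ((StdForm.antidiagonal 3).over K) M}}
    (hw : (latticeGraph σ ϖ ((StdForm.antidiagonal 3).over K)).dist (A i) w + (latticeGraph σ ϖ ((StdForm.antidiagonal 3).over K)).dist w (A k) =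
      (latticeGraph σ ϖ ((StdForm.antidiagonal 3).over K)).dist (A i) (A k)) :
    ∃ j : ℤ, i ≤ j ∧ j ≤ k ∧ w = A j :=
  SequencePath.exists_eq_of_dist_add_dist_eq hT A (latticeGraph_adj_apartmentEnum_succ_of_involution hσ hvσ hϖ A hA0 hA1) (apartmentEnum_injective_of_involution hϖ A hA0 hA1) hik hw

/-- **`dist (u·A i) (u·A k) = |k − i|`** for `u ∈ U(σ, J₀)` (tree hypothesis `hT`). [cite: BruhatTits1972, §10] [cite: Serre1980Trees, I.2.2 Prop. 8] -/
theorem dist_latticeGraphIso_apartmentEnum_of_involution (hT : (latticeGraph σ ϖ ((StdForm.antidiagonal 3).over K)).IsTree)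
    (u : unitaryGroupOfForm σ ((StdForm.antidiagonal 3).over K)) (i k : ℤ) :
    (latticeGraph σ ϖ ((StdForm.antidiagonal 3).over K)).dist (latticeGraphIso σ ϖ ((StdForm.antidiagonal 3).over K) u (A i))
      (latticeGraphIso σ ϖ ((StdForm.antidiagonal 3).over K) u (A k)) = (k - i).natAbs := by
  rw [TreeLayers.dist_iso_apply, dist_apartmentEnum_of_involution hσ hvσ hϖ A hA0 hA1 hT]

/-- **Every vertex on the geodesic `[u·A i, u·A k]` (`i ≤ k`) is `u·A j` with `i ≤ j ≤ k`** (tree hypothesis `hT`). [cite: BruhatTits1972, §10] [cite: Serre1980Trees, I.2.2 Prop. 8] -/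
theorem exists_eq_latticeGraphIso_apartmentEnum_of_dist_add_dist_eq_of_involution (hT : (latticeGraph σ ϖ ((StdForm.antidiagonal 3).over K)).IsTree)
    (u : unitaryGroupOfForm σ ((StdForm.antidiagonal 3).over K)) {i k : ℤ} (hik : i ≤ k)
    {w : {M : Submodule 𝒪[K] (Fin 3 → K) // IsVertex σ ϖ ((StdForm.antidiagonal 3).over K) M}}
    (hw : (latticeGraph σ ϖ ((StdForm.antidiagonal 3).over K)).dist (latticeGraphIso σ ϖ ((StdForm.antidiagonal 3).over K) u (A i)) w +
        (latticeGraph σ ϖ ((StdForm.antidiagonal 3).over K)).dist w (latticeGraphIso σ ϖ ((StdForm.antidiagonal 3).over K) u (A k)) =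
      (latticeGraph σ ϖ ((StdForm.antidiagonal 3).over K)).dist (latticeGraphIso σ ϖ ((StdForm.antidiagonal 3).over K) u (A i))
        (latticeGraphIso σ ϖ ((StdForm.antidiagonal 3).over K) u (A k))) :
    ∃ j : ℤ, i ≤ j ∧ j ≤ k ∧ w = latticeGraphIso σ ϖ ((StdForm.antidiagonal 3).over K) u (A j) :=
  SequencePath.exists_eq_of_dist_add_dist_eq hT (fun j => latticeGraphIso σ ϖ ((StdForm.antidiagonal 3).over K) u (A j))
    (fun j => ((latticeGraphIso σ ϖ ((StdForm.antidiagonal 3).over K) u).map_adj_iff).2 (latticeGraph_adj_apartmentEnum_succ_of_involution hσ hvσ hϖ A hA0 hA1 j))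
    ((latticeGraphIso σ ϖ ((StdForm.antidiagonal 3).over K) u).injective.comp (apartmentEnum_injective_of_involution hϖ A hA0 hA1)) hik hw

/-! ## §2 Two vertices lie in one translate of the standard apartment — hypothesis-style: tree `hT`, self-dual frames `hfr`, type-two transitivity `htr₂` -/

/-- **TWO SELF-DUAL VERTICES LIE IN ONE APARTMENT TRANSLATE** (`x = u·A 0`, `z = u·A (2b)`, `0 ≤ b`), given the FRAMES `hfr` of self-dual vertices (`L = κ·L_a`, `κ ∈ K₀`): as ★
row 39γ, with the involution torus element `diag(ϖ^a, 1, (σϖ)^{−a})` (★ R5a) in place of `diag(ϖ^a, 1, ϖ^{−a})` and ★ `w₀ ∈ K₀` reversing the sign of `b`.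
[cite: BruhatTits1972, (7.4.18), §10] [cite: Serre1980Trees, II.1.1] -/
theorem exists_latticeGraphIso_apartmentEnum_of_isSelfDualLattice₂_of_involution
    (hfr : ∀ M : Submodule 𝒪[K] (Fin 3 → K), IsSelfDualLattice σ ϖ ((StdForm.antidiagonal 3).over K) M →
      ∃ k : unitaryGroupOfForm σ ((StdForm.antidiagonal 3).over K), k ∈ unitaryInt σ ((StdForm.antidiagonal 3).over K) ∧
        ∃ a : ℤ, M = mapGL (k : GL (Fin 3) K) (latt (Matrix.diagonal ![ϖ ^ a, 1, ϖ ^ (-a)])))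
    {x z : {M : Submodule 𝒪[K] (Fin 3 → K) // IsVertex σ ϖ ((StdForm.antidiagonal 3).over K) M}}
    (hx : IsSelfDualLattice σ ϖ ((StdForm.antidiagonal 3).over K) x.1) (hz : IsSelfDualLattice σ ϖ ((StdForm.antidiagonal 3).over K) z.1) :
    ∃ u : unitaryGroupOfForm σ ((StdForm.antidiagonal 3).over K), ∃ b : ℤ, 0 ≤ b ∧
      x = latticeGraphIso σ ϖ ((StdForm.antidiagonal 3).over K) u (A 0) ∧ z = latticeGraphIso σ ϖ ((StdForm.antidiagonal 3).over K) u (A (2 * b)) := by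
  have hϖ0 : ϖ ≠ 0 := uniformizer_ne_zero hϖ
  -- `x = k · t_a · L₀` with the involution torus element `t = diag(ϖ^a, 1, (σϖ)^{−a})`
  obtain ⟨k, hk, a, hxa⟩ := hfr x.1 hx
  obtain ⟨t, ht⟩ := exists_coe_eq_diagonal_zpow_of_involution (K := K) hσ hϖ0 a
  have hA0' : (A 0).1 = stdLattice K 3 := coe_apartmentEnum_zero A hA0
  have htL : mapGL (t : GL (Fin 3) K) (A 0).1 = latt (Matrix.diagonal ![ϖ ^ a, (1 : K), ϖ ^ (-a)]) := by
    rw [hA0', ← latt_one, mapGL_coe_latt_eq t ht, Matrix.mul_one, latt_diagonal_map_zpow_eq hvσ hϖ0]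
  have hxg : x.1 = mapGL ((k * t : unitaryGroupOfForm σ ((StdForm.antidiagonal 3).over K)) : GL (Fin 3) K) (A 0).1 := by
    rw [Subgroup.coe_mul, mapGL_mul, htL, hxa]
  -- `g⁻¹ z` is self-dual, hence `= k′ · L_b`
  set g : unitaryGroupOfForm σ ((StdForm.antidiagonal 3).over K) := k * t with hg
  have hz' : IsSelfDualLattice σ ϖ ((StdForm.antidiagonal 3).over K) (mapGL ((g⁻¹ : unitaryGroupOfForm σ ((StdForm.antidiagonal 3).over K)) : GL (Fin 3) K) z.1) :=
    (isVertexLattice_mapGL_iff σ ϖ ((StdForm.antidiagonal 3).over K) g⁻¹ z.1).2 hz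
  obtain ⟨k', hk', b, hzb⟩ := hfr _ hz'
  have hz1 : z.1 = mapGL ((g * k' : unitaryGroupOfForm σ ((StdForm.antidiagonal 3).over K)) : GL (Fin 3) K) (A (2 * b)).1 := by
    rw [hA0, Subgroup.coe_mul, mapGL_mul, ← hzb, ← mapGL_mul, Subgroup.coe_inv, mul_inv_cancel, mapGL_one]
  have hx1 : x.1 = mapGL ((g * k' : unitaryGroupOfForm σ ((StdForm.antidiagonal 3).over K)) : GL (Fin 3) K) (A 0).1 := by
    rw [Subgroup.coe_mul, mapGL_mul, hA0', mapGL_stdLattice_of_mem_unitaryInt hk', ← hA0', ← hxg]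
  rcases le_or_gt 0 b with hb | hb
  · exact ⟨g * k', b, hb, Subtype.ext hx1, Subtype.ext hz1⟩
  · -- reverse the apartment with `w₀ ∈ K₀`
    refine ⟨g * k' * UnitaryGroup.weylLongU σ rfl, -b, by omega, Subtype.ext ?_, Subtype.ext ?_⟩
    · change x.1 = mapGL _ (A 0).1
      rw [Subgroup.coe_mul, mapGL_mul, hA0', mapGL_stdLattice_of_mem_unitaryInt (weylLongU_mem_unitaryInt hvσ), ← hA0', hx1]
    · change z.1 = mapGL _ (A (2 * -b)).1
      rw [Subgroup.coe_mul, mapGL_mul, mapGL_weylLongU_apartmentEnum A hA0 hA1, show -(2 * -b) = 2 * b by ring, hz1]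

omit hσ hvσ hϖ hA0 in
/-- **A TYPE-TWO VERTEX IS `v · A (−1) = v · N₁`** for some `v ∈ U(σ, J₀)`, given type-two transitivity `htr₂` (★ at unramified places; ★ `…_of_neg` at tame ramified ones).
[cite: BruhatTits1972, §10] -/
theorem exists_eq_latticeGraphIso_apartmentEnum_neg_one_of_involution
    (htr₂ : ∀ M : Submodule 𝒪[K] (Fin 3 → K), IsVertexLattice σ ϖ ((StdForm.antidiagonal 3).over K) 2 M →
      ∃ u : unitaryGroupOfForm σ ((StdForm.antidiagonal 3).over K), M = mapGL (u : GL (Fin 3) K) (latt (Matrix.diagonal ![(1 : K), 1, ϖ])))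
    {z : {M : Submodule 𝒪[K] (Fin 3 → K) // IsVertex σ ϖ ((StdForm.antidiagonal 3).over K) M}}
    (hz : IsVertexLattice σ ϖ ((StdForm.antidiagonal 3).over K) 2 z.1) :
    ∃ v : unitaryGroupOfForm σ ((StdForm.antidiagonal 3).over K), z = latticeGraphIso σ ϖ ((StdForm.antidiagonal 3).over K) v (A (-1)) := by
  obtain ⟨v, hv⟩ := htr₂ z.1 hz
  refine ⟨v, Subtype.ext ?_⟩
  change z.1 = mapGL _ (A (-1)).1
  rw [hv, show (-1 : ℤ) = 2 * (-1) + 1 by ring, hA1, show (-1 + 1 : ℤ) = 0 by ring, zpow_zero, neg_neg, zpow_one]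

section Frames

variable (hT : (latticeGraph σ ϖ ((StdForm.antidiagonal 3).over K)).IsTree)
  (hfr : ∀ M : Submodule 𝒪[K] (Fin 3 → K), IsSelfDualLattice σ ϖ ((StdForm.antidiagonal 3).over K) M →
    ∃ k : unitaryGroupOfForm σ ((StdForm.antidiagonal 3).over K), k ∈ unitaryInt σ ((StdForm.antidiagonal 3).over K) ∧
      ∃ a : ℤ, M = mapGL (k : GL (Fin 3) K) (latt (Matrix.diagonal ![ϖ ^ a, 1, ϖ ^ (-a)])))
include hT hfr

/-- **A SELF-DUAL VERTEX AND ANY VERTEX LIE IN ONE APARTMENT TRANSLATE** (`x = u·A 0`, `z = u·A k`, `0 ≤ k`), given `hT`, `hfr`, `htr₂` — proof = ★ row 39γ's (a type-two `z`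
is pushed to an outward self-dual neighbour, ★ `SequencePath.exists_dist_eq_succ_of_adj_of_adj`). [cite: BruhatTits1972, (7.4.18), §10] [cite: Serre1980Trees, I.2.2, II.1.1] -/
theorem exists_latticeGraphIso_apartmentEnum_of_isSelfDualLattice_of_involution
    (htr₂ : ∀ M : Submodule 𝒪[K] (Fin 3 → K), IsVertexLattice σ ϖ ((StdForm.antidiagonal 3).over K) 2 M →
      ∃ u : unitaryGroupOfForm σ ((StdForm.antidiagonal 3).over K), M = mapGL (u : GL (Fin 3) K) (latt (Matrix.diagonal ![(1 : K), 1, ϖ])))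
    {x : {M : Submodule 𝒪[K] (Fin 3 → K) // IsVertex σ ϖ ((StdForm.antidiagonal 3).over K) M}}
    (hx : IsSelfDualLattice σ ϖ ((StdForm.antidiagonal 3).over K) x.1) (z : {M : Submodule 𝒪[K] (Fin 3 → K) // IsVertex σ ϖ ((StdForm.antidiagonal 3).over K) M}) :
    ∃ u : unitaryGroupOfForm σ ((StdForm.antidiagonal 3).over K), ∃ k : ℤ, 0 ≤ k ∧
      x = latticeGraphIso σ ϖ ((StdForm.antidiagonal 3).over K) u (A 0) ∧ z = latticeGraphIso σ ϖ ((StdForm.antidiagonal 3).over K) u (A k) := by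
  obtain ⟨d, hzd⟩ := z.2
  rcases type_eq_zero_or_two_of_isVertexLattice_three hvσ hϖ v_det_antidiagonal_three hzd with rfl | rfl
  · obtain ⟨u, b, hb, hxu, hzu⟩ := exists_latticeGraphIso_apartmentEnum_of_isSelfDualLattice₂_of_involution hσ hvσ hϖ A hA0 hA1 hfr hx hzd
    exact ⟨u, 2 * b, by omega, hxu, hzu⟩
  · -- `z = v · A (−1)` with self-dual neighbours `v · A 0`, `v · A (−2)`
    obtain ⟨v, hzv⟩ := exists_eq_latticeGraphIso_apartmentEnum_neg_one_of_involution A hA1 htr₂ hzd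
    have hadj : ∀ j : ℤ, (latticeGraph σ ϖ ((StdForm.antidiagonal 3).over K)).Adj (latticeGraphIso σ ϖ ((StdForm.antidiagonal 3).over K) v (A j))
        (latticeGraphIso σ ϖ ((StdForm.antidiagonal 3).over K) v (A (j + 1))) :=
      fun j => ((latticeGraphIso σ ϖ ((StdForm.antidiagonal 3).over K) v).map_adj_iff).2 (latticeGraph_adj_apartmentEnum_succ_of_involution hσ hvσ hϖ A hA0 hA1 j)
    have h₀ : (latticeGraph σ ϖ ((StdForm.antidiagonal 3).over K)).Adj z (latticeGraphIso σ ϖ ((StdForm.antidiagonal 3).over K) v (A 0)) := by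
      rw [hzv]; have := hadj (-1); rwa [show (-1 + 1 : ℤ) = 0 by ring] at this
    have h₁ : (latticeGraph σ ϖ ((StdForm.antidiagonal 3).over K)).Adj z (latticeGraphIso σ ϖ ((StdForm.antidiagonal 3).over K) v (A (-2))) := by
      rw [hzv]; have := hadj (-2); rw [show (-2 + 1 : ℤ) = -1 by ring] at this; exact this.symm
    have hne : latticeGraphIso σ ϖ ((StdForm.antidiagonal 3).over K) v (A 0) ≠ latticeGraphIso σ ϖ ((StdForm.antidiagonal 3).over K) v (A (-2)) := by
      intro h
      have := apartmentEnum_injective_of_involution hϖ A hA0 hA1 ((latticeGraphIso σ ϖ ((StdForm.antidiagonal 3).over K) v).injective h)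
      omega
    -- self-duality of the two neighbours
    have hsd : ∀ b : ℤ, IsSelfDualLattice σ ϖ ((StdForm.antidiagonal 3).over K) (latticeGraphIso σ ϖ ((StdForm.antidiagonal 3).over K) v (A (2 * b))).1 := by
      intro b
      change IsVertexLattice σ ϖ ((StdForm.antidiagonal 3).over K) 0 (mapGL _ (A (2 * b)).1)
      rw [isVertexLattice_mapGL_iff, hA0]
      exact isSelfDualLattice_latt_diagonal_zpow_of_v hσ hvσ hϖ b
    -- the outward neighbour `c` and the placement of `(x, c)`
    have key : ∀ c : {M : Submodule 𝒪[K] (Fin 3 → K) // IsVertex σ ϖ ((StdForm.antidiagonal 3).over K) M},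
        IsSelfDualLattice σ ϖ ((StdForm.antidiagonal 3).over K) c.1 → (latticeGraph σ ϖ ((StdForm.antidiagonal 3).over K)).Adj z c →
        (latticeGraph σ ϖ ((StdForm.antidiagonal 3).over K)).dist x c = (latticeGraph σ ϖ ((StdForm.antidiagonal 3).over K)).dist x z + 1 →
        ∃ u : unitaryGroupOfForm σ ((StdForm.antidiagonal 3).over K), ∃ k : ℤ, 0 ≤ k ∧
          x = latticeGraphIso σ ϖ ((StdForm.antidiagonal 3).over K) u (A 0) ∧ z = latticeGraphIso σ ϖ ((StdForm.antidiagonal 3).over K) u (A k) := by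
      intro c hc hzc hdc
      obtain ⟨u, b, hb, hxu, hcu⟩ := exists_latticeGraphIso_apartmentEnum_of_isSelfDualLattice₂_of_involution hσ hvσ hϖ A hA0 hA1 hfr hx hc
      have hzc1 : (latticeGraph σ ϖ ((StdForm.antidiagonal 3).over K)).dist z c = 1 := SimpleGraph.dist_eq_one_iff_adj.2 hzc
      have hbetween : (latticeGraph σ ϖ ((StdForm.antidiagonal 3).over K)).dist x z + (latticeGraph σ ϖ ((StdForm.antidiagonal 3).over K)).dist z c =
          (latticeGraph σ ϖ ((StdForm.antidiagonal 3).over K)).dist x c := by rw [hzc1, hdc]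
      rw [hxu, hcu] at hbetween
      obtain ⟨j, hj0, -, hzj⟩ := exists_eq_latticeGraphIso_apartmentEnum_of_dist_add_dist_eq_of_involution hσ hvσ hϖ A hA0 hA1 hT u (by omega : (0 : ℤ) ≤ 2 * b) hbetween
      exact ⟨u, j, hj0, hxu, hzj⟩
    rcases SequencePath.exists_dist_eq_succ_of_adj_of_adj hT x h₀ h₁ hne with h | h
    · exact key _ (by simpa using hsd 0) h₀ h
    · exact key _ (by simpa using hsd (-1)) h₁ h

/-- **ANY TWO VERTICES LIE IN ONE TRANSLATE OF THE STANDARD APARTMENT**, hypothesis-style (`hT`, `hfr`, `htr₂`): `x = u·A i`, `z = u·A k`, `i ≤ k` — ★ row 39γ's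
`exists_latticeGraphIso_apartmentEnum_pair` re-derived for any isometric involution. [cite: BruhatTits1972, (7.4.18), §10] [cite: Serre1980Trees, I.2.2, II.1.1] -/
theorem exists_latticeGraphIso_apartmentEnum_pair_of_involution
    (htr₂ : ∀ M : Submodule 𝒪[K] (Fin 3 → K), IsVertexLattice σ ϖ ((StdForm.antidiagonal 3).over K) 2 M →
      ∃ u : unitaryGroupOfForm σ ((StdForm.antidiagonal 3).over K), M = mapGL (u : GL (Fin 3) K) (latt (Matrix.diagonal ![(1 : K), 1, ϖ])))
    (x z : {M : Submodule 𝒪[K] (Fin 3 → K) // IsVertex σ ϖ ((StdForm.antidiagonal 3).over K) M}) :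
    ∃ u : unitaryGroupOfForm σ ((StdForm.antidiagonal 3).over K), ∃ i k : ℤ, i ≤ k ∧
      x = latticeGraphIso σ ϖ ((StdForm.antidiagonal 3).over K) u (A i) ∧ z = latticeGraphIso σ ϖ ((StdForm.antidiagonal 3).over K) u (A k) := by
  obtain ⟨d, hxd⟩ := x.2
  rcases type_eq_zero_or_two_of_isVertexLattice_three hvσ hϖ v_det_antidiagonal_three hxd with rfl | rfl
  · obtain ⟨u, k, hk, hxu, hzu⟩ := exists_latticeGraphIso_apartmentEnum_of_isSelfDualLattice_of_involution hσ hvσ hϖ A hA0 hA1 hT hfr htr₂ hxd z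
    exact ⟨u, 0, k, hk, hxu, hzu⟩
  · obtain ⟨v, hxv⟩ := exists_eq_latticeGraphIso_apartmentEnum_neg_one_of_involution A hA1 htr₂ hxd
    have hadj : ∀ j : ℤ, (latticeGraph σ ϖ ((StdForm.antidiagonal 3).over K)).Adj (latticeGraphIso σ ϖ ((StdForm.antidiagonal 3).over K) v (A j))
        (latticeGraphIso σ ϖ ((StdForm.antidiagonal 3).over K) v (A (j + 1))) :=
      fun j => ((latticeGraphIso σ ϖ ((StdForm.antidiagonal 3).over K) v).map_adj_iff).2 (latticeGraph_adj_apartmentEnum_succ_of_involution hσ hvσ hϖ A hA0 hA1 j)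
    have h₀ : (latticeGraph σ ϖ ((StdForm.antidiagonal 3).over K)).Adj x (latticeGraphIso σ ϖ ((StdForm.antidiagonal 3).over K) v (A 0)) := by
      rw [hxv]; have := hadj (-1); rwa [show (-1 + 1 : ℤ) = 0 by ring] at this
    have h₁ : (latticeGraph σ ϖ ((StdForm.antidiagonal 3).over K)).Adj x (latticeGraphIso σ ϖ ((StdForm.antidiagonal 3).over K) v (A (-2))) := by
      rw [hxv]; have := hadj (-2); rw [show (-2 + 1 : ℤ) = -1 by ring] at this; exact this.symm
    have hne : latticeGraphIso σ ϖ ((StdForm.antidiagonal 3).over K) v (A 0) ≠ latticeGraphIso σ ϖ ((StdForm.antidiagonal 3).over K) v (A (-2)) := by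
      intro h
      have := apartmentEnum_injective_of_involution hϖ A hA0 hA1 ((latticeGraphIso σ ϖ ((StdForm.antidiagonal 3).over K) v).injective h)
      omega
    have hsd : ∀ b : ℤ, IsSelfDualLattice σ ϖ ((StdForm.antidiagonal 3).over K) (latticeGraphIso σ ϖ ((StdForm.antidiagonal 3).over K) v (A (2 * b))).1 := by
      intro b
      change IsVertexLattice σ ϖ ((StdForm.antidiagonal 3).over K) 0 (mapGL _ (A (2 * b)).1)
      rw [isVertexLattice_mapGL_iff, hA0]
      exact isSelfDualLattice_latt_diagonal_zpow_of_v hσ hvσ hϖ b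
    have key : ∀ c : {M : Submodule 𝒪[K] (Fin 3 → K) // IsVertex σ ϖ ((StdForm.antidiagonal 3).over K) M},
        IsSelfDualLattice σ ϖ ((StdForm.antidiagonal 3).over K) c.1 → (latticeGraph σ ϖ ((StdForm.antidiagonal 3).over K)).Adj x c →
        (latticeGraph σ ϖ ((StdForm.antidiagonal 3).over K)).dist z c = (latticeGraph σ ϖ ((StdForm.antidiagonal 3).over K)).dist z x + 1 →
        ∃ u : unitaryGroupOfForm σ ((StdForm.antidiagonal 3).over K), ∃ i k : ℤ, i ≤ k ∧
          x = latticeGraphIso σ ϖ ((StdForm.antidiagonal 3).over K) u (A i) ∧ z = latticeGraphIso σ ϖ ((StdForm.antidiagonal 3).over K) u (A k) := by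
      intro c hc hxc hdc
      obtain ⟨u, k, hk, hcu, hzu⟩ := exists_latticeGraphIso_apartmentEnum_of_isSelfDualLattice_of_involution hσ hvσ hϖ A hA0 hA1 hT hfr htr₂ hc z
      have hcx1 : (latticeGraph σ ϖ ((StdForm.antidiagonal 3).over K)).dist c x = 1 := SimpleGraph.dist_eq_one_iff_adj.2 hxc.symm
      have hbetween : (latticeGraph σ ϖ ((StdForm.antidiagonal 3).over K)).dist c x + (latticeGraph σ ϖ ((StdForm.antidiagonal 3).over K)).dist x z =
          (latticeGraph σ ϖ ((StdForm.antidiagonal 3).over K)).dist c z := by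
        rw [hcx1, SimpleGraph.dist_comm (u := c) (v := z), hdc, SimpleGraph.dist_comm (u := z) (v := x), add_comm]
      rw [hcu, hzu] at hbetween
      obtain ⟨j, hj0, hjk, hxj⟩ := exists_eq_latticeGraphIso_apartmentEnum_of_dist_add_dist_eq_of_involution hσ hvσ hϖ A hA0 hA1 hT u hk hbetween
      exact ⟨u, j, k, hjk, hxj, hzu⟩
    rcases SequencePath.exists_dist_eq_succ_of_adj_of_adj hT z h₀ h₁ hne with h | h
    · exact key _ (by simpa using hsd 0) h₀ h
    · exact key _ (by simpa using hsd (-1)) h₁ h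

/-- **THE GEODESIC BETWEEN TWO VERTICES LIES IN ONE APARTMENT TRANSLATE**, hypothesis-style: with `x = u·A i`, `z = u·A k`, `i ≤ k`, moreover `dist x z = k − i` and every
`w` on `[x, z]` is `u·A j`, `i ≤ j ≤ k`. [cite: BruhatTits1972, (7.4.18), §10] [cite: Serre1980Trees, I.2.2 Prop. 8] -/
theorem exists_latticeGraphIso_apartmentEnum_geodesic_of_involution
    (htr₂ : ∀ M : Submodule 𝒪[K] (Fin 3 → K), IsVertexLattice σ ϖ ((StdForm.antidiagonal 3).over K) 2 M →
      ∃ u : unitaryGroupOfForm σ ((StdForm.antidiagonal 3).over K), M = mapGL (u : GL (Fin 3) K) (latt (Matrix.diagonal ![(1 : K), 1, ϖ])))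
    (x z : {M : Submodule 𝒪[K] (Fin 3 → K) // IsVertex σ ϖ ((StdForm.antidiagonal 3).over K) M}) :
    ∃ u : unitaryGroupOfForm σ ((StdForm.antidiagonal 3).over K), ∃ i k : ℤ, i ≤ k ∧
      x = latticeGraphIso σ ϖ ((StdForm.antidiagonal 3).over K) u (A i) ∧ z = latticeGraphIso σ ϖ ((StdForm.antidiagonal 3).over K) u (A k) ∧
      ((latticeGraph σ ϖ ((StdForm.antidiagonal 3).over K)).dist x z : ℤ) = k - i ∧
      ∀ w, (latticeGraph σ ϖ ((StdForm.antidiagonal 3).over K)).dist x w + (latticeGraph σ ϖ ((StdForm.antidiagonal 3).over K)).dist w z =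
          (latticeGraph σ ϖ ((StdForm.antidiagonal 3).over K)).dist x z →
        ∃ j : ℤ, i ≤ j ∧ j ≤ k ∧ w = latticeGraphIso σ ϖ ((StdForm.antidiagonal 3).over K) u (A j) := by
  obtain ⟨u, i, k, hik, hxu, hzu⟩ := exists_latticeGraphIso_apartmentEnum_pair_of_involution hσ hvσ hϖ A hA0 hA1 hT hfr htr₂ x z
  refine ⟨u, i, k, hik, hxu, hzu, ?_, fun w hw => ?_⟩
  · rw [hxu, hzu, dist_latticeGraphIso_apartmentEnum_of_involution hσ hvσ hϖ A hA0 hA1 hT]; omega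
  · rw [hxu, hzu] at hw
    exact exists_eq_latticeGraphIso_apartmentEnum_of_dist_add_dist_eq_of_involution hσ hvσ hϖ A hA0 hA1 hT u hik hw

/-- **THE (U7) CONSUMER SHAPE, hypothesis-style**: for `x ~ y` with `y` the first step of `[x, z]` (`dist y z + 1 = dist x z`) there are `u ∈ U(σ, J₀)` and `i + 1 ≤ k` with
`(x, y, z) = u·(A i, A (i+1), A k)`. [cite: SchneiderStuhler1997, Prop. I.3.1 p. 118] [cite: BruhatTits1972, (7.4.18), §10] -/
theorem exists_latticeGraphIso_apartmentEnum_of_adj_of_dist_of_involution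
    (htr₂ : ∀ M : Submodule 𝒪[K] (Fin 3 → K), IsVertexLattice σ ϖ ((StdForm.antidiagonal 3).over K) 2 M →
      ∃ u : unitaryGroupOfForm σ ((StdForm.antidiagonal 3).over K), M = mapGL (u : GL (Fin 3) K) (latt (Matrix.diagonal ![(1 : K), 1, ϖ])))
    {x y z : {M : Submodule 𝒪[K] (Fin 3 → K) // IsVertex σ ϖ ((StdForm.antidiagonal 3).over K) M}}
    (hxy : (latticeGraph σ ϖ ((StdForm.antidiagonal 3).over K)).Adj x y)
    (hyz : (latticeGraph σ ϖ ((StdForm.antidiagonal 3).over K)).dist y z + 1 = (latticeGraph σ ϖ ((StdForm.antidiagonal 3).over K)).dist x z) :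
    ∃ u : unitaryGroupOfForm σ ((StdForm.antidiagonal 3).over K), ∃ i k : ℤ, i + 1 ≤ k ∧
      x = latticeGraphIso σ ϖ ((StdForm.antidiagonal 3).over K) u (A i) ∧ y = latticeGraphIso σ ϖ ((StdForm.antidiagonal 3).over K) u (A (i + 1)) ∧
      z = latticeGraphIso σ ϖ ((StdForm.antidiagonal 3).over K) u (A k) := by
  obtain ⟨u, i, k, hik, hxu, hzu, -, hgeo⟩ := exists_latticeGraphIso_apartmentEnum_geodesic_of_involution hσ hvσ hϖ A hA0 hA1 hT hfr htr₂ x z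
  have hxy1 : (latticeGraph σ ϖ ((StdForm.antidiagonal 3).over K)).dist x y = 1 := SimpleGraph.dist_eq_one_iff_adj.2 hxy
  obtain ⟨j, hij, hjk, hyj⟩ := hgeo y (by rw [hxy1, ← hyz, add_comm])
  have hj : j = i + 1 := by
    have h1 : (latticeGraph σ ϖ ((StdForm.antidiagonal 3).over K)).dist x y = (j - i).natAbs := by
      rw [hxu, hyj, dist_latticeGraphIso_apartmentEnum_of_involution hσ hvσ hϖ A hA0 hA1 hT]
    rw [hxy1] at h1
    omega
  subst hj
  exact ⟨u, i, k, hjk, hxu, hyj, hzu⟩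

end Frames

end Enum

end Literature.NumberTheory.Automorphic.UnitaryLatticeTree
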